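import Literature.IUT.LogVolume.TameTraceDifferent
import Literature.IUT.LogVolume.DifferentEstimatesCorollaries
import Literature.IUT.LogVolume.IsometryEmbeddingOrder
import Literature.IUT.LogVolume.DyadicPrimeResidueEmbeddingOrder
import HarnessLib

/-!
# WILD ⟺ `p ∣ e`: the trace-form hypothesis of the dividing line IS wild ramification

abc-iut cell, seat abc-iut-E-t42 (gen 6; rung LADDER-ABC:A2.E / A2.RESCUE.J, R-J row Y-29b «dividing line of the isometric (Ind2)»).
PROOF-ONLY classical local arithmetic (Serre, *Local Fields* III §3 Prop. 7, §6 Prop. 13); no definition, no `Prop` fact, no `sorry`.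
The two kernel halves of row Y-29b under the isometric (Ind2) are keyed to ONE hypothesis on a `p`-adic field `K = K_v`:
`hwild := ∀ x, ‖x‖ ≤ 1 → ‖Tr_{K/ℚ_p} x‖ < 1` (negative half `Summit.ABC.IUTFork.Joshi.PinsIsometricShear…`, p457646) versus `¬ hwild`
(positive half `TameDualPair` p464861 / `EmbeddingOrder` p470964 / `Summit.ABC.IUTFork.Joshi.PinsIsometricLine…` p471465).  This
seat's `TameTraceDifferent` (p465827) translated the key into [IUTchIV]'s `d` (`hwild ⟺ 1 ≤ d`); abc-iut-L5-t15's
`DifferentEstimatesCorollaries` has Serre III §6 Prop. 13 in the cell's normalisation (`p ∤ e ⟹ d = (e−1)/e`, `p ∣ e ⟹ 1 ≤ d`).  HERE the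
three are joined into the textbook invariant — the absolute ramification index `e = e(K/ℚ_p)` (abc-iut-S1's `absRamificationIdx`):

* §1 **`forall_norm_trace_lt_one_iff_dvd_absRamificationIdx`** — `hwild ⟺ p ∣ e`: the trace form is wild on the integers iff `K/ℚ_p` is
  WILDLY RAMIFIED; `not_wild_of_not_dvd_absRamificationIdx` (tame ⟹ `¬ hwild`), **`not_wild_of_absRamificationIdx_eq_one`** (UNRAMIFIED ⟹
  `¬ hwild` — the sequel named in this seat's gen-5 handoff), `not_wild_of_absRamificationIdx_lt` (`e < p`), `wild_of_dvd_absRamificationIdx`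
  (`p ∣ e ⟹ hwild` — supplies the NEGATIVE half's hypothesis from the ramification index), `not_dvd_absRamificationIdx_of_not_dvd_finrank`
  (abc-iut-E-t52's degree criterion `p ∤ [K:ℚ_p]`, p467826, is the special case `e ∣ [K:ℚ_p]`; its header left the converse open:
  «an unramified `K` of degree `p` is tame too» — covered here), and the elementwise form `exists_trace_eq_one_iff_not_dvd_absRamificationIdx`
  (`Tr(𝒪_K) ∋ 1 ⟺ p ∤ e`, with `norm_trace_le_norm`: `‖Tr x‖ ≤ ‖x‖`).
* §2 **`exists_embeddingOrder_repr_of_isometry_of_not_dvd_absRamificationIdx`** — `p ∤ e` ⟹ every `ℚ_p`-linear isometry `g` of `K` has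
  `ι∘g = Σ_τ c_τ·τ`, `ι∘g⁻¹ = Σ_τ c′_τ·τ` over the embeddings `τ : K → ℚ̄_p`, `‖c_τ‖, ‖c′_τ‖ ≤ 1` — NO Galois hypothesis (p470964);
  `…_of_absRamificationIdx_eq_one` (unramified); `exists_galoisOrder_repr_of_isometry_of_not_dvd_absRamificationIdx` (Galois form, p464861).
* §3 **`congr_image_normalizedPacket_eq_of_isometries_of_not_dvd_absRamificationIdx`** — ANY packet shape `⊗_{i∈I} k_i` (finite non-empty
  `I`, mixed slot fields), every slot TAMELY ramified (`p ∤ e_i`) ⟹ every tuple of factorwise `ℚ_p`-linear isometries maps `(R_I)^∼` onto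
  itself (`EmbeddingOrder.congr_image_normalizedPacket_of_embeddingOrder`); `…natCast_smul…` for the boxes `n·(R_I)^∼`;
  `not_exists_isometry_mover_of_not_dvd_absRamificationIdx`; and `congr_image_normalizedPacket_eq_of_not_dvd_absRamificationIdx_or_primeResidue`
  — the n-slot rider's STABLE half (abc-iut-E-cx-2's `congr_image_normalizedPacket_eq_of_tame_or_primeResidue`, p485211) with its TAME
  alternative read as `p ∤ e_i`.

So, in the classical invariant: at a place `v ∣ p`, `p ∤ e_v` (tame or unramified) ⟹ nothing isometric moves the log-shell boxes;
`p ∣ e_v` ⟹ `hwild`, the hypothesis under which (for odd `p`) the cell's isometric shear moves them (p457646).  Nothing here is disputed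
mathematics; the consumer rows are the cell's typings [claim: Mochizuki2012, status: disputed] of (Ind2).
[cite: SerreLocalFields1979, Ch. III §3, Prop. 7; §6, Prop. 13] [cite: NeukirchANT1999, Ch. II (4.8)] [cite: Mochizuki2012, IUTchIV Prop. 1.1 p. 9]
-/

noncomputable section

open Module
open scoped Pointwise

namespace Literature.IUT.LogVolume

namespace TameRamification

variable {p : ℕ} [Fact p.Prime]
variable {K : Type} [NontriviallyNormedField K] [NormedAlgebra ℚ_[p] K] [IsUltrametricDist K] [ProperSpace K]

/-! ## §1 The criterion: WILD trace form ⟺ `p ∣ e` -/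

variable (p K) in
/-- **WILD ⟺ `p ∣ e`.**  The trace form of `K/ℚ_p` is wild on the integers — `∀ x, ‖x‖ ≤ 1 → ‖Tr_{K/ℚ_p} x‖ < 1`, i.e. `Tr(𝒪_K) ⊆ p·ℤ_p`,
the hypothesis `hwild` of the cell's negative half (p457646) — iff `p` divides the absolute ramification index `e = e(K/ℚ_p)`, i.e. iff
`K/ℚ_p` is WILDLY RAMIFIED.  Proof: `hwild ⟺ 1 ≤ d` (this seat's `TameDualPair.forall_norm_trace_lt_one_iff_one_le_differentOrd`, Serre III
§3 Prop. 7) and Serre III §6 Prop. 13 in the cell's normalisation `ord(p) = 1` (abc-iut-L5-t15): `p ∣ e ⟹ 1 ≤ d`, `p ∤ e ⟹ d = (e−1)/e < 1`.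
[cite: SerreLocalFields1979, Ch. III §3, Prop. 7; §6, Prop. 13] [cite: Mochizuki2012, IUTchIV Prop. 1.1 p. 9] -/
theorem forall_norm_trace_lt_one_iff_dvd_absRamificationIdx :
    (∀ x : K, ‖x‖ ≤ 1 → ‖Algebra.trace ℚ_[p] K x‖ < 1) ↔ p ∣ absRamificationIdx p K := by
  rw [TameDualPair.forall_norm_trace_lt_one_iff_one_le_differentOrd p K]
  refine ⟨fun h => ?_, one_le_differentOrd_of_dvd p K⟩
  by_contra hnd
  rw [differentOrd_eq_of_not_dvd p K hnd] at h
  have he : (0 : ℝ) < absRamificationIdx p K := by exact_mod_cast absRamificationIdx_pos p K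
  rw [le_div_iff₀ he, one_mul] at h
  linarith

variable (p K) in
/-- **TAME ⟺ `p ∤ e`** (the negation of the criterion). [cite: SerreLocalFields1979, Ch. III §6, Prop. 13] -/
theorem not_forall_norm_trace_lt_one_iff_not_dvd_absRamificationIdx :
    (¬ ∀ x : K, ‖x‖ ≤ 1 → ‖Algebra.trace ℚ_[p] K x‖ < 1) ↔ ¬ p ∣ absRamificationIdx p K :=
  not_congr (forall_norm_trace_lt_one_iff_dvd_absRamificationIdx p K)

/-- **Tamely ramified ⟹ not wild**: `p ∤ e(K/ℚ_p)` ⟹ `¬ ∀ x, ‖x‖ ≤ 1 → ‖Tr x‖ < 1` (`Tr(𝒪_K) = ℤ_p`) — the field hypothesis of the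
cell's positive half (p464861 / p470964 / p471465) discharged by the ramification index. [cite: SerreLocalFields1979, Ch. III §6, Prop. 13] -/
theorem not_wild_of_not_dvd_absRamificationIdx (h : ¬ p ∣ absRamificationIdx p K) :
    ¬ ∀ x : K, ‖x‖ ≤ 1 → ‖Algebra.trace ℚ_[p] K x‖ < 1 :=
  (not_forall_norm_trace_lt_one_iff_not_dvd_absRamificationIdx p K).mpr h

/-- **UNRAMIFIED ⟹ not wild**: `e(K/ℚ_p) = 1` ⟹ `¬ ∀ x, ‖x‖ ≤ 1 → ‖Tr x‖ < 1` (a prime does not divide `1`).  This is the sequel named in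
this seat's gen-5 handoff: with it the positive half's tameness hypothesis need only be asked AT THE RAMIFIED PLACES (Joshi-side companion
`Summit.ABC.IUTFork.Joshi.PinsIsometricIndex…`). [cite: SerreLocalFields1979, Ch. III §6, Prop. 13] -/
theorem not_wild_of_absRamificationIdx_eq_one (h : absRamificationIdx p K = 1) :
    ¬ ∀ x : K, ‖x‖ ≤ 1 → ‖Algebra.trace ℚ_[p] K x‖ < 1 :=
  not_wild_of_not_dvd_absRamificationIdx (by rw [h]; exact (Fact.out : p.Prime).not_dvd_one)

/-- **Small ramification ⟹ not wild**: `e(K/ℚ_p) < p` ⟹ `¬ hwild` (`0 < e < p` forces `p ∤ e`); e.g. every `K_v` with `[K_v:ℚ_p] < p`.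
[cite: SerreLocalFields1979, Ch. III §6, Prop. 13] -/
theorem not_wild_of_absRamificationIdx_lt (h : absRamificationIdx p K < p) :
    ¬ ∀ x : K, ‖x‖ ≤ 1 → ‖Algebra.trace ℚ_[p] K x‖ < 1 :=
  not_wild_of_not_dvd_absRamificationIdx (Nat.not_dvd_of_pos_of_lt (absRamificationIdx_pos p K) h)

/-- **Wildly ramified ⟹ wild**: `p ∣ e(K/ℚ_p)` ⟹ `∀ x, ‖x‖ ≤ 1 → ‖Tr x‖ < 1` — the hypothesis `hwild` of the cell's NEGATIVE half
(`Summit.ABC.IUTFork.Joshi.PinsIsometricShear.not_pinnedRegions_honestSetting_of_isometries_of_wild`, p457646) supplied by the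
ramification index; e.g. `ℚ_p(ζ_{p²})`, `ℚ_p(p^{1/p})`, every `K_v` with `p ∣ e_v`. [cite: SerreLocalFields1979, Ch. III §6, Prop. 13] -/
theorem wild_of_dvd_absRamificationIdx (h : p ∣ absRamificationIdx p K) :
    ∀ x : K, ‖x‖ ≤ 1 → ‖Algebra.trace ℚ_[p] K x‖ < 1 :=
  (forall_norm_trace_lt_one_iff_dvd_absRamificationIdx p K).mpr h

/-- **`p ∤ [K:ℚ_p] ⟹ p ∤ e`** (`e·f = [K:ℚ_p]`, abc-iut-S1's `absRamificationIdx_mul_residueDegree`): abc-iut-E-t52's degree criterion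
`TameDegree.not_wild_of_not_dvd_finrank` (p467826) is the special case `e ∣ [K:ℚ_p]` of `not_wild_of_not_dvd_absRamificationIdx`; the
converse fails (an unramified `K` of degree `p` has `p ∣ [K:ℚ_p]`, `p ∤ e = 1`). [cite: SerreLocalFields1979, Ch. III §6, Prop. 13] -/
theorem not_dvd_absRamificationIdx_of_not_dvd_finrank (h : ¬ p ∣ finrank ℚ_[p] K) : ¬ p ∣ absRamificationIdx p K := fun he =>
  h (absRamificationIdx_mul_residueDegree p K ▸ dvd_mul_of_dvd_left he _)

/-- E-t52's criterion recovered: `p ∤ [K:ℚ_p] ⟹ ¬ hwild`, now THROUGH the ramification index. [cite: SerreLocalFields1979, Ch. III §6, Prop. 13] -/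
theorem not_wild_of_not_dvd_finrank' (h : ¬ p ∣ finrank ℚ_[p] K) : ¬ ∀ x : K, ‖x‖ ≤ 1 → ‖Algebra.trace ℚ_[p] K x‖ < 1 :=
  not_wild_of_not_dvd_absRamificationIdx (not_dvd_absRamificationIdx_of_not_dvd_finrank h)

/-- **`‖Tr_{K/ℚ_p} x‖ ≤ ‖x‖`**: `Tr x = Σ_σ σ(x)` over the `[K:ℚ_p]` embeddings `σ : K → ℚ̄_p` (Mathlib `trace_eq_sum_embeddings`), each an
isometry (campaign-S `norm_map_algHom`), and `ℚ̄_p` is ultrametric.  In particular `Tr(𝒪_K) ⊆ ℤ_p`. [cite: NeukirchANT1999, Ch. II (4.8)] -/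
theorem norm_trace_le_norm (x : K) : ‖Algebra.trace ℚ_[p] K x‖ ≤ ‖x‖ := by
  haveI := finiteDimensional p K
  obtain ⟨ι⟩ := EmbeddingOrder.nonempty_algHom_padicAlgCl (p := p) (K := K)
  have h := trace_eq_sum_embeddings (PadicAlgCl p) (K := ℚ_[p]) (L := K) (x := x)
  rw [← norm_algebraMap' (PadicAlgCl p) (Algebra.trace ℚ_[p] K x), h]
  exact IsUltrametricDist.norm_sum_le_of_forall_le_of_nonneg (norm_nonneg x) fun σ _ => (norm_map_algHom σ x).le

variable (p K) in
/-- **`1 ∈ Tr(𝒪_K) ⟺ p ∤ e`** — the elementwise form of «tame ⟺ `Tr(𝒪_K) = ℤ_p`»: there is an integer `x ∈ 𝒪_K` of trace EXACTLY `1`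
iff `K/ℚ_p` is tamely ramified.  (⟸: `¬ hwild` gives `‖x‖ ≤ 1` with `‖Tr x‖ ≥ 1`, hence `= 1` by `norm_trace_le_norm`; rescale by the unit
`(Tr x)⁻¹ ∈ ℤ_p^×`.) [cite: SerreLocalFields1979, Ch. III §3, Prop. 7; §6, Prop. 13] -/
theorem exists_trace_eq_one_iff_not_dvd_absRamificationIdx :
    (∃ x : K, ‖x‖ ≤ 1 ∧ Algebra.trace ℚ_[p] K x = 1) ↔ ¬ p ∣ absRamificationIdx p K := by
  rw [← not_forall_norm_trace_lt_one_iff_not_dvd_absRamificationIdx p K]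
  constructor
  · rintro ⟨x, hx, htr⟩ hw
    have h := hw x hx
    rw [htr, norm_one] at h
    exact lt_irrefl _ h
  · intro hw
    push Not at hw
    obtain ⟨x, hx, htr⟩ := hw
    set t : ℚ_[p] := Algebra.trace ℚ_[p] K x with ht
    have ht1 : ‖t‖ = 1 := le_antisymm ((norm_trace_le_norm x).trans hx) htr
    have ht0 : t ≠ 0 := fun h0 => by rw [h0, norm_zero] at ht1; exact zero_ne_one ht1
    refine ⟨t⁻¹ • x, ?_, ?_⟩
    · rw [norm_smul, norm_inv, ht1, inv_one, one_mul]; exact hx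
    · rw [map_smul, smul_eq_mul, ← ht, inv_mul_cancel₀ ht0]

/-! ## §2 Isometries at a tamely ramified field are embedding-order units — no Galois hypothesis -/

/-- **`p ∤ e` ⟹ every `ℚ_p`-linear isometry is a unit of the integral EMBEDDING order.**  For `K/ℚ_p` tamely ramified (`p ∤ e(K/ℚ_p)`;
Galois or not), every `ℚ_p`-linear isometry `g` of `K` and every embedding `ι : K → ℚ̄_p` have `ι∘g = Σ_τ c_τ·τ` and `ι∘g⁻¹ = Σ_τ c′_τ·τ`
over the embeddings `τ : K → ℚ̄_p` with `‖c_τ‖, ‖c′_τ‖ ≤ 1` (this seat's `EmbeddingOrder.exists_embeddingOrder_repr_of_isometry_of_not_wild`,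
p470964, its `¬ hwild` discharged by §1) — verbatim the per-place binder of the cell's positive half `PinsIsometricLine` (p471465).
[cite: SerreLocalFields1979, Ch. III §3, Prop. 7; §6, Prop. 13] [cite: NeukirchANT1999, Ch. II (4.8)] -/
theorem exists_embeddingOrder_repr_of_isometry_of_not_dvd_absRamificationIdx (h : ¬ p ∣ absRamificationIdx p K)
    (g : K ≃ₗ[ℚ_[p]] K) (hg : ∀ x, ‖g x‖ = ‖x‖) (ι : K →ₐ[ℚ_[p]] PadicAlgCl p) :
    (∃ (T : Finset (K →ₐ[ℚ_[p]] PadicAlgCl p)) (c : (K →ₐ[ℚ_[p]] PadicAlgCl p) → PadicAlgCl p),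
      (∀ τ ∈ T, ‖c τ‖ ≤ 1) ∧ ∀ x, ι (g x) = ∑ τ ∈ T, c τ * τ x) ∧
    (∃ (T : Finset (K →ₐ[ℚ_[p]] PadicAlgCl p)) (c : (K →ₐ[ℚ_[p]] PadicAlgCl p) → PadicAlgCl p),
      (∀ τ ∈ T, ‖c τ‖ ≤ 1) ∧ ∀ x, ι (g.symm x) = ∑ τ ∈ T, c τ * τ x) :=
  EmbeddingOrder.exists_embeddingOrder_repr_of_isometry_of_not_wild (not_wild_of_not_dvd_absRamificationIdx h) g hg ι

/-- **UNRAMIFIED ⟹ every `ℚ_p`-linear isometry is an embedding-order unit** (`e = 1`). [cite: NeukirchANT1999, Ch. II (4.8)] -/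
theorem exists_embeddingOrder_repr_of_isometry_of_absRamificationIdx_eq_one (h : absRamificationIdx p K = 1)
    (g : K ≃ₗ[ℚ_[p]] K) (hg : ∀ x, ‖g x‖ = ‖x‖) (ι : K →ₐ[ℚ_[p]] PadicAlgCl p) :
    (∃ (T : Finset (K →ₐ[ℚ_[p]] PadicAlgCl p)) (c : (K →ₐ[ℚ_[p]] PadicAlgCl p) → PadicAlgCl p),
      (∀ τ ∈ T, ‖c τ‖ ≤ 1) ∧ ∀ x, ι (g x) = ∑ τ ∈ T, c τ * τ x) ∧
    (∃ (T : Finset (K →ₐ[ℚ_[p]] PadicAlgCl p)) (c : (K →ₐ[ℚ_[p]] PadicAlgCl p) → PadicAlgCl p),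
      (∀ τ ∈ T, ‖c τ‖ ≤ 1) ∧ ∀ x, ι (g.symm x) = ∑ τ ∈ T, c τ * τ x) :=
  EmbeddingOrder.exists_embeddingOrder_repr_of_isometry_of_not_wild (not_wild_of_absRamificationIdx_eq_one h) g hg ι

/-- **Galois form**: `K/ℚ_p` Galois with `p ∤ e` ⟹ every `ℚ_p`-linear isometry is a unit of the integral Galois order `𝒪_K⟨Gal(K/ℚ_p)⟩`
(this seat's `TameDualPair.exists_galoisOrder_repr_of_isometry_of_not_wild`, p464861) — the `hIsmG` binder of the cell's `PinsGaloisOrder`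
(p460152). [cite: SerreLocalFields1979, Ch. III §3, Prop. 7; §6, Prop. 13] -/
theorem exists_galoisOrder_repr_of_isometry_of_not_dvd_absRamificationIdx [FiniteDimensional ℚ_[p] K] [IsGalois ℚ_[p] K]
    (h : ¬ p ∣ absRamificationIdx p K) (g : K ≃ₗ[ℚ_[p]] K) (hg : ∀ x, ‖g x‖ = ‖x‖) :
    (∃ (T : Finset (K ≃ₐ[ℚ_[p]] K)) (c : (K ≃ₐ[ℚ_[p]] K) → K), (∀ τ ∈ T, ‖c τ‖ ≤ 1) ∧ ∀ x, g x = ∑ τ ∈ T, c τ * τ x) ∧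
    (∃ (T : Finset (K ≃ₐ[ℚ_[p]] K)) (c : (K ≃ₐ[ℚ_[p]] K) → K), (∀ τ ∈ T, ‖c τ‖ ≤ 1) ∧ ∀ x, g.symm x = ∑ τ ∈ T, c τ * τ x) :=
  TameDualPair.exists_galoisOrder_repr_of_isometry_of_not_wild (not_wild_of_not_dvd_absRamificationIdx h) g hg

/-- **Isometries at a tamely ramified field map the unit ball AND the embedding order to themselves; conversely** an embedding-order
element with embedding-order inverse is an isometry (p470964's `norm_map_eq_of_embeddingOrder`) — so at `p ∤ e` the two classes
«isometries» and «embedding-order units» COINCIDE. [cite: NeukirchANT1999, Ch. II (4.8)] -/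
theorem isometry_iff_embeddingOrder_unit_of_not_dvd_absRamificationIdx (h : ¬ p ∣ absRamificationIdx p K) (g : K ≃ₗ[ℚ_[p]] K) :
    (∀ x, ‖g x‖ = ‖x‖) ↔
    ((∃ (ι : K →ₐ[ℚ_[p]] PadicAlgCl p) (T : Finset (K →ₐ[ℚ_[p]] PadicAlgCl p)) (c : (K →ₐ[ℚ_[p]] PadicAlgCl p) → PadicAlgCl p),
        (∀ τ ∈ T, ‖c τ‖ ≤ 1) ∧ ∀ x, ι (g x) = ∑ τ ∈ T, c τ * τ x) ∧
      (∃ (ι : K →ₐ[ℚ_[p]] PadicAlgCl p) (T : Finset (K →ₐ[ℚ_[p]] PadicAlgCl p)) (c : (K →ₐ[ℚ_[p]] PadicAlgCl p) → PadicAlgCl p),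
        (∀ τ ∈ T, ‖c τ‖ ≤ 1) ∧ ∀ x, ι (g.symm x) = ∑ τ ∈ T, c τ * τ x)) := by
  refine ⟨fun hg => ?_, fun ⟨h1, h2⟩ x => EmbeddingOrder.norm_map_eq_of_embeddingOrder g h1 h2 x⟩
  obtain ⟨ι⟩ := EmbeddingOrder.nonempty_algHom_padicAlgCl (p := p) (K := K)
  obtain ⟨h1, h2⟩ := exists_embeddingOrder_repr_of_isometry_of_not_dvd_absRamificationIdx h g hg ι
  exact ⟨⟨ι, h1⟩, ⟨ι, h2⟩⟩

/-! ## §3 Tensor packets of any shape: tamely ramified slots are never moved by factorwise isometries -/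

section Packet

variable (p) {I : Type} [Fintype I] [DecidableEq I] [Nonempty I]
  (k : I → Type) [∀ i, NontriviallyNormedField (k i)] [∀ i, NormedAlgebra ℚ_[p] (k i)]
  [∀ i, IsUltrametricDist (k i)] [∀ i, ProperSpace (k i)]

/-- **ANY packet shape, every slot TAMELY ramified ⟹ `(⊗_i g_i)((R_I)^∼) = (R_I)^∼` for every tuple of factorwise `ℚ_p`-linear
isometries.**  For slot fields `k_i` (`i ∈ I`, finite non-empty `I`, the fields need not coincide) with `p ∤ e(k_i/ℚ_p)` for all `i`, every
`g_i` and `g_i⁻¹` is an embedding-order unit (§2), so this seat's `EmbeddingOrder.congr_image_normalizedPacket_of_embeddingOrder` (p470964: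
injective `⊗ι_i`, integrality reflection) applies.  The STABLE half of row Y-29b's n-slot rider in the classical invariant `e_i`.
[cite: Mochizuki2012, IUTchIV Prop. 1.1 p. 9] [cite: SerreLocalFields1979, Ch. III §6, Prop. 13] -/
theorem congr_image_normalizedPacket_eq_of_isometries_of_not_dvd_absRamificationIdx
    (he : ∀ i, ¬ p ∣ absRamificationIdx p (k i)) (g : ∀ i, k i ≃ₗ[ℚ_[p]] k i) (hg : ∀ i x, ‖g i x‖ = ‖x‖) :
    (PiTensorProduct.congr g : PacketAlgebra p k ≃ₗ[ℚ_[p]] PacketAlgebra p k) ''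
        (normalizedPacket p k : Set (PacketAlgebra p k)) = normalizedPacket p k := by
  have hg' : ∀ i x, ‖(g i).symm x‖ = ‖x‖ := fun i x => by
    conv_rhs => rw [← (g i).apply_symm_apply x]
    rw [hg]
  have key : ∀ i, ∃ ι : k i →ₐ[ℚ_[p]] PadicAlgCl p, True := fun i =>
    ⟨Classical.choice (EmbeddingOrder.nonempty_algHom_padicAlgCl (p := p) (K := k i)), trivial⟩
  choose ι _ using key
  exact EmbeddingOrder.congr_image_normalizedPacket_of_embeddingOrder p k g
    (fun i => ⟨ι i, (exists_embeddingOrder_repr_of_isometry_of_not_dvd_absRamificationIdx (he i) (g i) (hg i) (ι i)).1⟩)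
    (fun i => ⟨ι i, (exists_embeddingOrder_repr_of_isometry_of_not_dvd_absRamificationIdx (he i) (g i) (hg i) (ι i)).2⟩)

/-- … hence `(⊗_i g_i)(n·(R_I)^∼) = n·(R_I)^∼` for every `n : ℕ` — the `p^λ·(R_I)^∼`-boxes of [IUTchIV] Prop. 1.1 / 1.4 are stable under all
factorwise isometries at tamely ramified slots. [cite: Mochizuki2012, IUTchIV Prop. 1.1 p. 9] -/
theorem congr_image_natCast_smul_normalizedPacket_eq_of_isometries_of_not_dvd_absRamificationIdx
    (he : ∀ i, ¬ p ∣ absRamificationIdx p (k i)) (g : ∀ i, k i ≃ₗ[ℚ_[p]] k i) (hg : ∀ i x, ‖g i x‖ = ‖x‖) (n : ℕ) :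
    (PiTensorProduct.congr g : PacketAlgebra p k ≃ₗ[ℚ_[p]] PacketAlgebra p k) ''
        ((n : PacketAlgebra p k) • (normalizedPacket p k : Set (PacketAlgebra p k))) =
      (n : PacketAlgebra p k) • (normalizedPacket p k : Set (PacketAlgebra p k)) := by
  have hg' : ∀ i x, ‖(g i).symm x‖ = ‖x‖ := fun i x => by
    conv_rhs => rw [← (g i).apply_symm_apply x]
    rw [hg]
  have key : ∀ i, ∃ ι : k i →ₐ[ℚ_[p]] PadicAlgCl p, True := fun i =>
    ⟨Classical.choice (EmbeddingOrder.nonempty_algHom_padicAlgCl (p := p) (K := k i)), trivial⟩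
  choose ι _ using key
  exact EmbeddingOrder.congr_image_natCast_smul_normalizedPacket_of_embeddingOrder p k g
    (fun i => ⟨ι i, (exists_embeddingOrder_repr_of_isometry_of_not_dvd_absRamificationIdx (he i) (g i) (hg i) (ι i)).1⟩)
    (fun i => ⟨ι i, (exists_embeddingOrder_repr_of_isometry_of_not_dvd_absRamificationIdx (he i) (g i) (hg i) (ι i)).2⟩) n

/-- **No isometric mover of `(R_I)^∼` exists at tamely ramified slots** (any packet shape): there are no factorwise isometries `g_i` and no
`z ∈ (R_I)^∼` with `(⊗ g_i) z ∉ (R_I)^∼`.  Contrast the cell's movers at WILD slots (`p ∣ e`: p457646 `p` odd; p458336 / p463369 / p469678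
at `p = 2` outside the residual class). [cite: Mochizuki2012, IUTchIV Prop. 1.1 p. 9] -/
theorem not_exists_isometry_mover_of_not_dvd_absRamificationIdx (he : ∀ i, ¬ p ∣ absRamificationIdx p (k i)) :
    ¬ ∃ (g : ∀ i, k i ≃ₗ[ℚ_[p]] k i) (_ : ∀ i x, ‖g i x‖ = ‖x‖) (z : PacketAlgebra p k),
        z ∈ normalizedPacket p k ∧
        (PiTensorProduct.congr g : PacketAlgebra p k ≃ₗ[ℚ_[p]] PacketAlgebra p k) z ∉ normalizedPacket p k := by
  rintro ⟨g, hg, z, hz, hmove⟩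
  have himg := congr_image_normalizedPacket_eq_of_isometries_of_not_dvd_absRamificationIdx p k he g hg
  have hmem : (PiTensorProduct.congr g : PacketAlgebra p k ≃ₗ[ℚ_[p]] PacketAlgebra p k) z ∈
      (PiTensorProduct.congr g : PacketAlgebra p k ≃ₗ[ℚ_[p]] PacketAlgebra p k) ''
        (normalizedPacket p k : Set (PacketAlgebra p k)) := Set.mem_image_of_mem _ hz
  rw [himg] at hmem
  exact hmove hmem

/-- **MIXED packets, TAME-OR-RESIDUAL, with TAME read as `p ∤ e_i`**: abc-iut-E-cx-2's n-slot stable half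
`DyadicPrimeResidue.congr_image_normalizedPacket_eq_of_tame_or_primeResidue` (p485211) with its first alternative supplied by the
ramification index — each slot either tamely ramified (`p ∤ e_i`) or on the residual dyadic class (units `≡ 1`, a uniformizer `π_i`, some
`‖x₀‖ ≤ ‖π_i‖⁻¹` with `‖Tr x₀‖ ≥ 1`) ⟹ `(⊗_i g_i)((R_I)^∼) = (R_I)^∼` for all factorwise isometries.
[cite: Mochizuki2012, IUTchIV Prop. 1.1 p. 9] [cite: SerreLocalFields1979, Ch. III §6, Prop. 13] -/
theorem congr_image_normalizedPacket_eq_of_not_dvd_absRamificationIdx_or_primeResidue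
    (hslot : ∀ i, (¬ p ∣ absRamificationIdx p (k i)) ∨
      ((∀ w : k i, ‖w‖ = 1 → ‖w - 1‖ < 1) ∧ ∃ π x₀ : k i, (∀ y : k i, ‖y‖ < 1 → ‖y‖ ≤ ‖π‖) ∧ ‖x₀‖ ≤ ‖π‖⁻¹ ∧
        1 ≤ ‖Algebra.trace ℚ_[p] (k i) x₀‖))
    (g : ∀ i, k i ≃ₗ[ℚ_[p]] k i) (hg : ∀ i x, ‖g i x‖ = ‖x‖) :
    (PiTensorProduct.congr g : PacketAlgebra p k ≃ₗ[ℚ_[p]] PacketAlgebra p k) ''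
        (normalizedPacket p k : Set (PacketAlgebra p k)) = normalizedPacket p k :=
  DyadicPrimeResidue.congr_image_normalizedPacket_eq_of_tame_or_primeResidue k
    (fun i => (hslot i).imp_left not_wild_of_not_dvd_absRamificationIdx) g hg

end Packet

end TameRamification

end Literature.IUT.LogVolume

end
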